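import Summits.QuantumFields.YangMills.Theorems.UnitScaleTiltProp7HermiteCardinalWeightsMass
import Literature.MathematicalPhysics.QuantumFieldTheory.Balaban1983to89.B5Eq117TorusCarriers
import HarnessLib

/-!
# Route `UnitScaleTilt`, crux K1 «MinimiserStabilityRegPr» (stmt-QuantumFields-19200), route-R E′ path (α′), row LEMMA-H-CURVED — FILE 3δ:
# COLUMN SUMS OF THE CARDINAL WEIGHTS OVER THE FINE TORUS: `Σ_x W_y(x) = ℓ^d`, `Σ_x |∂_μW_y(x)| ≤ 6ℓ^{d−1}`, `Σ_x |Δ²_μW_y(x)| ≤ 24ℓ^{d−2}`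

Cell `ym3-torus`, D-0154 (3c) twin-width seat `ym-routeR-w1` (gen 5); row "routeR-w1 g5: LEMMA-H-CURVED" (namer ★ym-ust-19200-p1 g14, 2026-08-28 17:33Z; design of record
(x2′-corner)).  THEOREMS ONLY (0 `def`, 0 `sorry`); `--supports stmt-QuantumFields-19200`, count-neutral.  YM₃ on T³ is a ladder rung (R3), not the Clay problem; nothing here
claims a stub, the crux, d = 4 or the mass gap.

WHY.  Squaring the master pointwise bound ✓ `Prop7HermiteCornerBlendCov.norm_lap_cornerBlend_le` and summing over the fine sites `x` moves every weight row from "mass in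
`y` at fixed `x`" (✓ `Prop7HermiteCardinalWeightsMass`) to "mass in `x` at fixed centre `y`": after Cauchy–Schwarz in `y` the energy count meets `Σ_x W_y(x)`,
`Σ_x |∂_μW_y(x)|` and `Σ_x |Δ²_μW_y(x)|`, each of which must be `O(ℓ^d)` times the pointwise size (`1`, `3∕ℓ`, `6∕ℓ²`) — i.e. the weights must be SUPPORTED ON `O(1)` CELLS
around `y`.  This file proves exactly these column sums, with explicit constants, by the block decomposition of the fine torus `x = ℓ·y′ + j (+ h)` (✓ `B5Eq117TorusCarriers.blockSiteK`,
`sum_iterBlock_eq`): at a block point the factor `E_ν(x, t)` reads `p(j_ν)·𝟙[y′_ν = t] + (1 − p(j_ν))·𝟙[y′_ν + 1 = t]`, the sum over the block label `y′` factorises over the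
coordinates, and each one-dimensional sum is `p(j_ν) + (1 − p(j_ν)) = 1`.

WHAT IS PROVED (ns `…Theorems.Prop7HermiteCardinalWeightsColumns`; `ℓ = L^k`, offset `h`, profile `p` abstract with displayed rows; `Q(x) = iterBlockOf k (x − h)`).
* §1 block bookkeeping: `iterBlockOf_blockSiteK`, `offset_blockSiteK`, `sum_block_decomp` (`Σ_x G(x − h) = Σ_(y′) Σ_j G(ℓy′ + j)`), `iterBlockOf_apply_longUnshift` (`Q_ν(x − ℓe_ν) = Q_ν(x) − 1`),
  one-dimensional sums `sum_ind_eq'`, `sum_ind_add_one_eq`, `sum_ind_sub_one_eq`, `sum_factorB_eq_one`, `sum_prod_coord`.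
* §2 indicator forms of the factor rows: `abs_diff_weightE_le_ind` (`|∂_μE_μ(x,t)| ≤ (3∕ℓ)(𝟙[Q_μ = t] + 𝟙[Q_μ+1 = t])`), `abs_secondDiff_weightE_le_ind`
  (`|Δ²_μE_μ(x,t)| ≤ (6∕ℓ²)(𝟙[Q_μ+1 = t] + 2·𝟙[Q_μ = t] + 𝟙[Q_μ−1 = t])`).
* §3 ★★ `sum_weight_col` (`Σ_x W_y(x) = ℓ^d`, exact), ★ `sum_F_mul_prod_erase` (`Σ_x F(Q_μ(x))·Π_(ν≠μ)E_ν(x,y_ν) = (Σ_t F t)·ℓ^d`), ★★ `sum_abs_diff_weight_col_le`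
  (`Σ_x |W_y(x+e_μ) − W_y(x)| ≤ (6∕ℓ)·ℓ^d`), ★★ `sum_abs_secondDiff_weight_col_le` (`Σ_x |W_y(x+e_μ) − 2W_y(x) + W_y(x−e_μ)| ≤ (24∕ℓ²)·ℓ^d`).
HONEST SCOPE.  Flat bookkeeping; nothing of Bałaban's is asserted.

References: T. Bałaban, CMP 95 (1984) 17–40 [Balaban1984PropagatorsI] ((1.18) p.20, (1.29)–(1.31) p.23).
-/

set_option autoImplicit false

noncomputable section

open scoped BigOperators

namespace Summit.QuantumFields.YangMills.Theorems.Prop7HermiteCardinalWeightsColumns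

open Literature.MathematicalPhysics.QuantumFieldTheory.Balaban1983to89
open Finset
open Summit.QuantumFields.YangMills.Theorems.Prop7TentInterpolation (shift_eq_update)
open Summit.QuantumFields.YangMills.Theorems.Prop7HermiteSecondDiff (hermStep_self_eq hermStep_shift_eq abs_secondDiff_hermStep_le)
open Summit.QuantumFields.YangMills.Theorems.Prop7HermiteInterpolation (sum_subConst)
open Summit.QuantumFields.YangMills.Theorems.Prop7HermiteCardinalWeights (iterBlockOf_apply_longShift ind_runConst hermStep_ind_eq weightE_nonneg secondDiff_weight_eq)
open Summit.QuantumFields.YangMills.Theorems.Prop7HermiteCardinalWeightsMass (sum_prod_factor diff_weight_eq)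
open B5Eq118OneStroke (iterBlockOf mem_iterBlock)
open B5Eq117TorusCarriers (blockSiteK val_blockSiteK blockSiteK_mem_iterBlock sum_iterBlock_eq)

variable {P : Params} {k : ℕ} (hk : k ≤ P.m + P.K) (h : ZMod (P.sitesPerDir 0)) (p : ℕ → ℝ)

/-! ## §1 Block bookkeeping and one-dimensional sums -/

section Block

include hk

omit h p in
/-- the block label of a block point: `Q(ℓ·y + j) = y`. [cite: Balaban1984PropagatorsI, (1.18) p.20] -/
theorem iterBlockOf_blockSiteK (y : Site P k) (j : Fin P.d → Fin (P.L ^ k)) : iterBlockOf k (blockSiteK k y j) = y :=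
  (mem_iterBlock k y _).1 (blockSiteK_mem_iterBlock hk y j)

omit h p in
/-- the offset of a block point: `(ℓ·y + j)_ν mod ℓ = j_ν`. [cite: Balaban1984PropagatorsI, (1.18) p.20] -/
theorem offset_blockSiteK (y : Site P k) (j : Fin P.d → Fin (P.L ^ k)) (ν : Fin P.d) : ((blockSiteK k y j) ν).val % P.L ^ k = (j ν : ℕ) := by
  rw [val_blockSiteK hk, Nat.mul_add_mod', Nat.mod_eq_of_lt (j ν).isLt]

omit p in
/-- ★ **BLOCK DECOMPOSITION OF A FINE-TORUS SUM** (translated by `h`): `Σ_x G(x − h) = Σ_(y′) Σ_j G(ℓ·y′ + j)`. [cite: Balaban1984PropagatorsI, (1.18) p.20] -/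
theorem sum_block_decomp (G : Site P 0 → ℝ) :
    ∑ x : Site P 0, G (fun κ => x κ - h) = ∑ y' : Site P k, ∑ j : Fin P.d → Fin (P.L ^ k), G (blockSiteK k y' j) := by
  rw [sum_subConst h G, ← Finset.sum_fiberwise (Finset.univ : Finset (Site P 0)) (iterBlockOf k) G]
  exact Finset.sum_congr rfl fun y' _ => sum_iterBlock_eq hk y' G

omit p in
/-- `Q(x − ℓe_ν)_ν = Q(x)_ν − 1` (one block down). [cite: Balaban1984PropagatorsI, (1.18) p.20] -/
theorem iterBlockOf_apply_longUnshift (x : Site P 0) (ν : Fin P.d) :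
    (iterBlockOf k (fun κ => (Function.update x ν (x ν - ((P.L ^ k : ℕ) : ZMod (P.sitesPerDir 0)))) κ - h)) ν = (iterBlockOf k (fun κ => x κ - h)) ν - 1 := by
  have e := iterBlockOf_apply_longShift hk h (Function.update x ν (x ν - ((P.L ^ k : ℕ) : ZMod (P.sitesPerDir 0)))) ν
  have hx : Function.update (Function.update x ν (x ν - ((P.L ^ k : ℕ) : ZMod (P.sitesPerDir 0)))) ν ((Function.update x ν (x ν - ((P.L ^ k : ℕ) : ZMod (P.sitesPerDir 0)))) ν + ((P.L ^ k : ℕ) : ZMod (P.sitesPerDir 0))) = x := by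
    rw [Function.update_self, sub_add_cancel, Function.update_idem, Function.update_eq_self]
  rw [hx] at e
  have e2 := congrFun e ν
  simp only [Site.shift, Function.update_self] at e2
  rw [e2, add_sub_cancel_right]

end Block

section OneDim

/-- `Σ_t 𝟙[t = c] = 1`. [folklore] -/
theorem sum_ind_eq' (c : ZMod (P.sitesPerDir k)) : ∑ t : ZMod (P.sitesPerDir k), (if t = c then (1 : ℝ) else 0) = 1 := by
  rw [Finset.sum_ite_eq']; simp

/-- `Σ_t 𝟙[t + 1 = c] = 1`. [folklore] -/
theorem sum_ind_add_one_eq (c : ZMod (P.sitesPerDir k)) : ∑ t : ZMod (P.sitesPerDir k), (if t + 1 = c then (1 : ℝ) else 0) = 1 := by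
  have h1 : ∀ t : ZMod (P.sitesPerDir k), (if t + 1 = c then (1 : ℝ) else 0) = (if t = c - 1 then (1 : ℝ) else 0) := by
    intro t
    by_cases ht : t + 1 = c
    · rw [if_pos ht, if_pos (eq_sub_iff_add_eq.mpr ht)]
    · rw [if_neg ht, if_neg (fun h' => ht (eq_sub_iff_add_eq.mp h'))]
  rw [Finset.sum_congr rfl fun t _ => h1 t, sum_ind_eq']

/-- `Σ_t 𝟙[t − 1 = c] = 1`. [folklore] -/
theorem sum_ind_sub_one_eq (c : ZMod (P.sitesPerDir k)) : ∑ t : ZMod (P.sitesPerDir k), (if t - 1 = c then (1 : ℝ) else 0) = 1 := by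
  have h1 : ∀ t : ZMod (P.sitesPerDir k), (if t - 1 = c then (1 : ℝ) else 0) = (if t = c + 1 then (1 : ℝ) else 0) := by
    intro t
    by_cases ht : t - 1 = c
    · rw [if_pos ht, if_pos (sub_eq_iff_eq_add.mp ht)]
    · rw [if_neg ht, if_neg (fun h' => ht (sub_eq_iff_eq_add.mpr h'))]
  rw [Finset.sum_congr rfl fun t _ => h1 t, sum_ind_eq']

/-- the one-dimensional column sum of a block-point factor: `Σ_t (a·𝟙[t = c] + (1 − a)·𝟙[t + 1 = c]) = 1`. [folklore] -/
theorem sum_factorB_eq_one (a : ℝ) (c : ZMod (P.sitesPerDir k)) :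
    ∑ t : ZMod (P.sitesPerDir k), (a * (if t = c then (1 : ℝ) else 0) + (1 - a) * (if t + 1 = c then (1 : ℝ) else 0)) = 1 := by
  rw [Finset.sum_add_distrib, ← Finset.mul_sum, ← Finset.mul_sum, sum_ind_eq', sum_ind_add_one_eq]; ring

/-- a sum over the block lattice of a product of coordinate functions factorises: `Σ_(y′) Π_ν f_ν(y′_ν) = Π_ν Σ_t f_ν(t)`. [folklore] -/
theorem sum_prod_coord (f : Fin P.d → ZMod (P.sitesPerDir k) → ℝ) :
    ∑ y' : Site P k, ∏ ν : Fin P.d, f ν (y' ν) = ∏ ν : Fin P.d, ∑ t : ZMod (P.sitesPerDir k), f ν t := by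
  rw [Finset.prod_univ_sum]
  rfl

end OneDim

/-! ## §2 Indicator forms of the factor rows -/

section Factor

include hk

/-- `|E_μ(x+e_μ,t) − E_μ(x,t)| ≤ (3∕ℓ)·(𝟙[Q_μ(x) = t] + 𝟙[Q_μ(x)+1 = t])` (slope row `|p(r+1) − p(r)| ≤ 3∕ℓ`, `p(0) = 1`, `p(ℓ) = 0`). [cite: Balaban1984PropagatorsI, (1.29)-(1.31) p.23] -/
theorem abs_diff_weightE_le_ind (hp0 : p 0 = 1) (hpℓ : p (P.L ^ k) = 0) (hpS : ∀ r : ℕ, r + 1 ≤ P.L ^ k → |p (r + 1) - p r| ≤ 3 / (((P.L ^ k : ℕ) : ℝ)))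
    (μ : Fin P.d) (t : ZMod (P.sitesPerDir k)) (x : Site P 0) :
    |(p (((x.shift μ) μ - h).val % P.L ^ k) * (if (iterBlockOf k (fun κ => (x.shift μ) κ - h)) μ = t then (1 : ℝ) else 0) + (1 - p (((x.shift μ) μ - h).val % P.L ^ k)) * (if (iterBlockOf k (fun κ => (x.shift μ) κ - h)) μ + 1 = t then (1 : ℝ) else 0)) - (p ((x μ - h).val % P.L ^ k) * (if (iterBlockOf k (fun κ => x κ - h)) μ = t then (1 : ℝ) else 0) + (1 - p ((x μ - h).val % P.L ^ k)) * (if (iterBlockOf k (fun κ => x κ - h)) μ + 1 = t then (1 : ℝ) else 0))| ≤ 3 / (((P.L ^ k : ℕ) : ℝ)) * ((if (iterBlockOf k (fun κ => x κ - h)) μ = t then (1 : ℝ) else 0) + (if (iterBlockOf k (fun κ => x κ - h)) μ + 1 = t then (1 : ℝ) else 0)) := by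
  have hℓN : P.L ^ k ∣ P.sitesPerDir 0 := ⟨P.sitesPerDir k, by
    unfold Params.sitesPerDir; rw [Nat.sub_zero, mul_left_comm, ← pow_add, Nat.add_sub_cancel' hk]⟩
  have hℓ : 0 < P.L ^ k := pow_pos P.L_pos k
  have hr : (x μ - h).val % P.L ^ k + 1 ≤ P.L ^ k := Nat.mod_lt _ hℓ
  have hpt : (p (((x.shift μ) μ - h).val % P.L ^ k) * (if (iterBlockOf k (fun κ => (x.shift μ) κ - h)) μ = t then (1 : ℝ) else 0) + (1 - p (((x.shift μ) μ - h).val % P.L ^ k)) * (if (iterBlockOf k (fun κ => (x.shift μ) κ - h)) μ + 1 = t then (1 : ℝ) else 0)) - (p ((x μ - h).val % P.L ^ k) * (if (iterBlockOf k (fun κ => x κ - h)) μ = t then (1 : ℝ) else 0) + (1 - p ((x μ - h).val % P.L ^ k)) * (if (iterBlockOf k (fun κ => x κ - h)) μ + 1 = t then (1 : ℝ) else 0)) = (p ((x μ - h).val % P.L ^ k + 1) - p ((x μ - h).val % P.L ^ k)) * ((fun z : Site P 0 => if (iterBlockOf k (fun κ => z κ - h)) μ = t then (1 : ℝ) else 0)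 x - (fun z : Site P 0 => if (iterBlockOf k (fun κ => z κ - h)) μ = t then (1 : ℝ) else 0) (Function.update x μ (x μ + ((P.L ^ k : ℕ) : ZMod (P.sitesPerDir 0))))) := by
    have hw := fun z => ind_runConst hk h μ μ t z
    rw [← hermStep_ind_eq hk h p μ t (x.shift μ), ← hermStep_ind_eq hk h p μ t x,
      hermStep_shift_eq (P.L ^ k) h p hℓN hℓ hp0 hpℓ μ _ hw x, hermStep_self_eq (P.L ^ k) h p hℓN μ _ hw x]
    ring
  have hq : (iterBlockOf k (fun κ => (Function.update x μ (x μ + ((P.L ^ k : ℕ) : ZMod (P.sitesPerDir 0)))) κ - h)) μ = (iterBlockOf k (fun κ => x κ - h)) μ + 1 := by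
    rw [iterBlockOf_apply_longShift hk h x μ]; simp only [Site.shift, Function.update_self]
  have hind : |(if (iterBlockOf k (fun κ => x κ - h)) μ = t then (1 : ℝ) else 0) - (if (iterBlockOf k (fun κ => (Function.update x μ (x μ + ((P.L ^ k : ℕ) : ZMod (P.sitesPerDir 0)))) κ - h)) μ = t then (1 : ℝ) else 0)|
      ≤ (if (iterBlockOf k (fun κ => x κ - h)) μ = t then (1 : ℝ) else 0) + (if (iterBlockOf k (fun κ => x κ - h)) μ + 1 = t then (1 : ℝ) else 0) := by
    rw [hq]; split_ifs <;> norm_num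
  rw [hpt, abs_mul]
  exact mul_le_mul (hpS _ hr) (by simpa only using hind) (abs_nonneg _) (by positivity)

/-- `|E_μ(x+e_μ,t) − 2E_μ(x,t) + E_μ(x−e_μ,t)| ≤ (6∕ℓ²)·(𝟙[Q_μ(x)+1 = t] + 2·𝟙[Q_μ(x) = t] + 𝟙[Q_μ(x)−1 = t])`. [cite: Balaban1984PropagatorsI, (1.29)-(1.31) p.23] -/
theorem abs_secondDiff_weightE_le_ind (hp0 : p 0 = 1) (hpℓ : p (P.L ^ k) = 0)
    (hpD : ∀ r : ℕ, 1 ≤ r → r + 1 ≤ P.L ^ k → |p (r + 1) - 2 * p r + p (r - 1)| ≤ 6 / (((P.L ^ k : ℕ) : ℝ)) ^ 2)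
    (hpc : p 1 + p (P.L ^ k - 1) = 1) (hpk0 : 0 ≤ p (P.L ^ k - 1)) (hpk : p (P.L ^ k - 1) ≤ 3 / (((P.L ^ k : ℕ) : ℝ)) ^ 2)
    (μ : Fin P.d) (t : ZMod (P.sitesPerDir k)) (x : Site P 0) :
    |(p (((x.shift μ) μ - h).val % P.L ^ k) * (if (iterBlockOf k (fun κ => (x.shift μ) κ - h)) μ = t then (1 : ℝ) else 0) + (1 - p (((x.shift μ) μ - h).val % P.L ^ k)) * (if (iterBlockOf k (fun κ => (x.shift μ) κ - h)) μ + 1 = t then (1 : ℝ) else 0)) - 2 * (p ((x μ - h).val % P.L ^ k) * (if (iterBlockOf k (fun κ => x κ - h)) μ = t then (1 : ℝ) else 0) + (1 - p ((x μ - h).val % P.L ^ k)) * (if (iterBlockOf k (fun κ => x κ - h)) μ + 1 = t then (1 : ℝ) else 0)) + (p (((x.unshift μ) μ - h).val % P.L ^ k) * (if (iterBlockOf k (fun κ => (x.unshift μ) κ - h)) μ = t then (1 : ℝ) else 0) + (1 - p (((x.unshift μ) μ - h).val % P.L ^ k)) * (if (iterBlockOf k (fun κ => (x.unshift μ) κ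 - h)) μ + 1 = t then (1 : ℝ) else 0))|
      ≤ 6 / (((P.L ^ k : ℕ) : ℝ)) ^ 2 * ((if (iterBlockOf k (fun κ => x κ - h)) μ + 1 = t then (1 : ℝ) else 0) + 2 * (if (iterBlockOf k (fun κ => x κ - h)) μ = t then (1 : ℝ) else 0) + (if (iterBlockOf k (fun κ => x κ - h)) μ - 1 = t then (1 : ℝ) else 0)) := by
  have hℓN : P.L ^ k ∣ P.sitesPerDir 0 := ⟨P.sitesPerDir k, by
    unfold Params.sitesPerDir; rw [Nat.sub_zero, mul_left_comm, ← pow_add, Nat.add_sub_cancel' hk]⟩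
  have hℓ : 0 < P.L ^ k := pow_pos P.L_pos k
  rw [← hermStep_ind_eq hk h p μ t (x.shift μ), ← hermStep_ind_eq hk h p μ t x, ← hermStep_ind_eq hk h p μ t (x.unshift μ)]
  have hb := abs_secondDiff_hermStep_le (P.L ^ k) h p hℓN hℓ hp0 hpℓ hpD hpc hpk0 hpk μ (fun z : Site P 0 => if (iterBlockOf k (fun κ => z κ - h)) μ = t then (1 : ℝ) else 0) (fun z => ind_runConst hk h μ μ t z) x
  refine hb.trans ?_
  have hq1 : (iterBlockOf k (fun κ => (Function.update x μ (x μ + ((P.L ^ k : ℕ) : ZMod (P.sitesPerDir 0)))) κ - h)) μ = (iterBlockOf k (fun κ => x κ - h)) μ + 1 := by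
    rw [iterBlockOf_apply_longShift hk h x μ]; simp only [Site.shift, Function.update_self]
  have hq2 : (iterBlockOf k (fun κ => (Function.update x μ (x μ - ((P.L ^ k : ℕ) : ZMod (P.sitesPerDir 0)))) κ - h)) μ = (iterBlockOf k (fun κ => x κ - h)) μ - 1 := iterBlockOf_apply_longUnshift hk h x μ
  have hind : |(if (iterBlockOf k (fun κ => (Function.update x μ (x μ + ((P.L ^ k : ℕ) : ZMod (P.sitesPerDir 0)))) κ - h)) μ = t then (1 : ℝ) else 0) - (if (iterBlockOf k (fun κ => x κ - h)) μ = t then (1 : ℝ) else 0)|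
      + |(if (iterBlockOf k (fun κ => x κ - h)) μ = t then (1 : ℝ) else 0) - (if (iterBlockOf k (fun κ => (Function.update x μ (x μ - ((P.L ^ k : ℕ) : ZMod (P.sitesPerDir 0)))) κ - h)) μ = t then (1 : ℝ) else 0)|
      ≤ (if (iterBlockOf k (fun κ => x κ - h)) μ + 1 = t then (1 : ℝ) else 0) + 2 * (if (iterBlockOf k (fun κ => x κ - h)) μ = t then (1 : ℝ) else 0) + (if (iterBlockOf k (fun κ => x κ - h)) μ - 1 = t then (1 : ℝ) else 0) := by
    rw [hq1, hq2]; split_ifs <;> norm_num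
  exact mul_le_mul_of_nonneg_left (by simpa only using hind) (by positivity)

end Factor

/-! ## §3 The column sums of the product weights -/

section Weight

include hk

/-- ★★ **TOTAL COLUMN MASS**: `Σ_x W_y(x) = ℓ^d` — every centre's weight has total mass exactly one block. [cite: Balaban1984PropagatorsI, (1.18) p.20, (1.29)-(1.31) p.23] -/
theorem sum_weight_col (y : Site P k) : ∑ x : Site P 0, (∏ ν : Fin P.d, (p ((x ν - h).val % P.L ^ k) * (if (iterBlockOf k (fun κ => x κ - h)) ν = y ν then (1 : ℝ) else 0) + (1 - p ((x ν - h).val % P.L ^ k)) * (if (iterBlockOf k (fun κ => x κ - h)) ν + 1 = y ν then (1 : ℝ) else 0))) = (((P.L ^ k : ℕ) : ℝ)) ^ P.d := by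
  have e := sum_block_decomp hk h (fun z => (∏ ν : Fin P.d, (p ((z ν).val % P.L ^ k) * (if (iterBlockOf k z) ν = y ν then (1 : ℝ) else 0) + (1 - p ((z ν).val % P.L ^ k)) * (if (iterBlockOf k z) ν + 1 = y ν then (1 : ℝ) else 0))))
  simp only [] at e
  rw [e]
  simp only [iterBlockOf_blockSiteK hk, offset_blockSiteK hk]
  rw [Finset.sum_comm]
  have hin : ∀ j : Fin P.d → Fin (P.L ^ k), ∑ y' : Site P k, (∏ ν : Fin P.d, (p (j ν) * (if y' ν = y ν then (1 : ℝ) else 0) + (1 - p (j ν)) * (if y' ν + 1 = y ν then (1 : ℝ) else 0))) = 1 := by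
    intro j
    have e2 := sum_prod_coord (P := P) (k := k) (fun ν t => p (j ν) * (if t = y ν then (1 : ℝ) else 0) + (1 - p (j ν)) * (if t + 1 = y ν then (1 : ℝ) else 0))
    rw [e2]
    exact Finset.prod_eq_one fun ν _ => sum_factorB_eq_one (p (j ν)) (y ν)
  rw [Finset.sum_congr rfl fun j _ => hin j, Finset.sum_const, Finset.card_univ, Fintype.card_fun, Fintype.card_fin, Fintype.card_fin,
    nsmul_eq_mul, mul_one, Nat.cast_pow]

/-- ★ **COLUMN SUM WITH ONE FREE FACTOR**: `Σ_x F(Q_μ(x))·Π_(ν≠μ) E_ν(x, y_ν) = (Σ_t F t)·ℓ^d`. [cite: Balaban1984PropagatorsI, (1.18) p.20, (1.29)-(1.31) p.23] -/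
theorem sum_F_mul_prod_erase (y : Site P k) (μ : Fin P.d) (F : ZMod (P.sitesPerDir k) → ℝ) :
    ∑ x : Site P 0, F ((iterBlockOf k (fun κ => x κ - h)) μ) * ∏ ν ∈ Finset.univ.erase μ, (p ((x ν - h).val % P.L ^ k) * (if (iterBlockOf k (fun κ => x κ - h)) ν = y ν then (1 : ℝ) else 0) + (1 - p ((x ν - h).val % P.L ^ k)) * (if (iterBlockOf k (fun κ => x κ - h)) ν + 1 = y ν then (1 : ℝ) else 0)) = (∑ t : ZMod (P.sitesPerDir k), F t) * (((P.L ^ k : ℕ) : ℝ)) ^ P.d := by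
  have e := sum_block_decomp hk h (fun z => F ((iterBlockOf k z) μ) * (∏ ν ∈ Finset.univ.erase μ, (p ((z ν).val % P.L ^ k) * (if (iterBlockOf k z) ν = y ν then (1 : ℝ) else 0) + (1 - p ((z ν).val % P.L ^ k)) * (if (iterBlockOf k z) ν + 1 = y ν then (1 : ℝ) else 0))))
  simp only [] at e
  rw [e]
  simp only [iterBlockOf_blockSiteK hk, offset_blockSiteK hk]
  rw [Finset.sum_comm]
  have hin : ∀ j : Fin P.d → Fin (P.L ^ k), ∑ y' : Site P k, F (y' μ) * (∏ ν ∈ Finset.univ.erase μ, (p (j ν) * (if y' ν = y ν then (1 : ℝ) else 0) + (1 - p (j ν)) * (if y' ν + 1 = y ν then (1 : ℝ) else 0))) = ∑ t : ZMod (P.sitesPerDir k), F t := by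
    intro j
    have e2 := sum_prod_factor (P := P) (k := k) μ F (fun ν t => p (j ν) * (if t = y ν then (1 : ℝ) else 0) + (1 - p (j ν)) * (if t + 1 = y ν then (1 : ℝ) else 0))
    rw [e2, Finset.prod_eq_one fun ν _ => sum_factorB_eq_one (p (j ν)) (y ν), mul_one]
  rw [Finset.sum_congr rfl fun j _ => hin j, Finset.sum_const, Finset.card_univ, Fintype.card_fun, Fintype.card_fin, Fintype.card_fin,
    nsmul_eq_mul, Nat.cast_pow, mul_comm]

/-- ★★ **COLUMN MASS OF THE GRADIENT**: `Σ_x |W_y(x+e_μ) − W_y(x)| ≤ (6∕ℓ)·ℓ^d`. [cite: Balaban1984PropagatorsI, (1.18) p.20, (1.29)-(1.31) p.23] -/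
theorem sum_abs_diff_weight_col_le (hp0 : p 0 = 1) (hpℓ : p (P.L ^ k) = 0) (hpS : ∀ r : ℕ, r + 1 ≤ P.L ^ k → |p (r + 1) - p r| ≤ 3 / (((P.L ^ k : ℕ) : ℝ)))
    (hp01 : ∀ r : ℕ, r < P.L ^ k → 0 ≤ p r ∧ p r ≤ 1) (y : Site P k) (μ : Fin P.d) :
    ∑ x : Site P 0, |(∏ ν : Fin P.d, (p (((x.shift μ) ν - h).val % P.L ^ k) * (if (iterBlockOf k (fun κ => (x.shift μ) κ - h)) ν = y ν then (1 : ℝ) else 0) + (1 - p (((x.shift μ) ν - h).val % P.L ^ k)) * (if (iterBlockOf k (fun κ => (x.shift μ) κ - h)) ν + 1 = y ν then (1 : ℝ) else 0))) - (∏ ν : Fin P.d, (p ((x ν - h).val % P.L ^ k) * (if (iterBlockOf k (fun κ => x κ - h)) ν = y ν then (1 : ℝ) else 0) + (1 - p ((x ν - h).val % P.L ^ k)) * (if (iterBlockOf k (fun κ => x κ - h)) ν + 1 = y ν then (1 : ℝ) else 0)))| ≤ 6 / (((P.L ^ k : ℕ) : ℝ)) * (((P.L ^ k : ℕ) : ℝ))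 ^ P.d := by
  have hnn : ∀ x : Site P 0, 0 ≤ ∏ ν ∈ Finset.univ.erase μ, (p ((x ν - h).val % P.L ^ k) * (if (iterBlockOf k (fun κ => x κ - h)) ν = y ν then (1 : ℝ) else 0) + (1 - p ((x ν - h).val % P.L ^ k)) * (if (iterBlockOf k (fun κ => x κ - h)) ν + 1 = y ν then (1 : ℝ) else 0)) :=
    fun x => Finset.prod_nonneg fun ν _ => weightE_nonneg h p hp01 ν (y ν) x
  have hpt : ∀ x : Site P 0, |(∏ ν : Fin P.d, (p (((x.shift μ) ν - h).val % P.L ^ k) * (if (iterBlockOf k (fun κ => (x.shift μ) κ - h)) ν = y ν then (1 : ℝ) else 0) + (1 - p (((x.shift μ) ν - h).val % P.L ^ k)) * (if (iterBlockOf k (fun κ => (x.shift μ) κ - h)) ν + 1 = y ν then (1 : ℝ) else 0))) - (∏ ν : Fin P.d, (p ((x ν - h).val % P.L ^ k) * (if (iterBlockOf k (fun κ => x κ - h)) ν = y ν then (1 : ℝ) else 0) + (1 - p ((x ν - h).val % P.L ^ k)) * (if (iterBlockOf k (fun κ => x κ - h)) ν + 1 = y ν then (1 : ℝ) else 0)))|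 ≤ 3 / (((P.L ^ k : ℕ) : ℝ)) * ((fun t : ZMod (P.sitesPerDir k) => (if t = y μ then (1 : ℝ) else 0) + (if t + 1 = y μ then (1 : ℝ) else 0)) ((iterBlockOf k (fun κ => x κ - h)) μ) * ∏ ν ∈ Finset.univ.erase μ, (p ((x ν - h).val % P.L ^ k) * (if (iterBlockOf k (fun κ => x κ - h)) ν = y ν then (1 : ℝ) else 0) + (1 - p ((x ν - h).val % P.L ^ k)) * (if (iterBlockOf k (fun κ => x κ - h)) ν + 1 = y ν then (1 : ℝ) else 0))) := by
    intro x
    rw [diff_weight_eq hk h p y μ x, abs_mul, abs_of_nonneg (hnn x), ← mul_assoc]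
    exact mul_le_mul_of_nonneg_right (abs_diff_weightE_le_ind hk h p hp0 hpℓ hpS μ (y μ) x) (hnn x)
  refine (Finset.sum_le_sum fun x _ => hpt x).trans ?_
  rw [← Finset.mul_sum, sum_F_mul_prod_erase hk h p y μ (fun t : ZMod (P.sitesPerDir k) => (if t = y μ then (1 : ℝ) else 0) + (if t + 1 = y μ then (1 : ℝ) else 0))]
  have h2 : ∑ t : ZMod (P.sitesPerDir k), (fun t : ZMod (P.sitesPerDir k) => (if t = y μ then (1 : ℝ) else 0) + (if t + 1 = y μ then (1 : ℝ) else 0)) t = 2 := by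
    simp only []
    rw [Finset.sum_add_distrib, sum_ind_eq', sum_ind_add_one_eq]; norm_num
  rw [h2]
  exact le_of_eq (by ring)

/-- ★★ **COLUMN MASS OF THE SECOND DIFFERENCE**: `Σ_x |W_y(x+e_μ) − 2W_y(x) + W_y(x−e_μ)| ≤ (24∕ℓ²)·ℓ^d`. [cite: Balaban1984PropagatorsI, (1.18) p.20, (1.29)-(1.31) p.23] -/
theorem sum_abs_secondDiff_weight_col_le (hp0 : p 0 = 1) (hpℓ : p (P.L ^ k) = 0)
    (hpD : ∀ r : ℕ, 1 ≤ r → r + 1 ≤ P.L ^ k → |p (r + 1) - 2 * p r + p (r - 1)| ≤ 6 / (((P.L ^ k : ℕ) : ℝ)) ^ 2)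
    (hpc : p 1 + p (P.L ^ k - 1) = 1) (hpk0 : 0 ≤ p (P.L ^ k - 1)) (hpk : p (P.L ^ k - 1) ≤ 3 / (((P.L ^ k : ℕ) : ℝ)) ^ 2)
    (hp01 : ∀ r : ℕ, r < P.L ^ k → 0 ≤ p r ∧ p r ≤ 1) (y : Site P k) (μ : Fin P.d) :
    ∑ x : Site P 0, |(∏ ν : Fin P.d, (p (((x.shift μ) ν - h).val % P.L ^ k) * (if (iterBlockOf k (fun κ => (x.shift μ) κ - h)) ν = y ν then (1 : ℝ) else 0) + (1 - p (((x.shift μ) ν - h).val % P.L ^ k)) * (if (iterBlockOf k (fun κ => (x.shift μ) κ - h)) ν + 1 = y ν then (1 : ℝ) else 0))) - 2 * (∏ ν : Fin P.d, (p ((x ν - h).val % P.L ^ k) * (if (iterBlockOf k (fun κ => x κ - h)) ν = y ν then (1 : ℝ) else 0) + (1 - p ((x ν - h).val % P.L ^ k)) * (if (iterBlockOf k (fun κ => x κ - h)) ν + 1 = y ν then (1 : ℝ) else 0))) + (∏ ν : Fin P.d, (p (((x.unshift μ) ν - h).val % P.L ^ k) * (if (iterBlockOf k (fun κ => (x.unshift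 μ) κ - h)) ν = y ν then (1 : ℝ) else 0) + (1 - p (((x.unshift μ) ν - h).val % P.L ^ k)) * (if (iterBlockOf k (fun κ => (x.unshift μ) κ - h)) ν + 1 = y ν then (1 : ℝ) else 0)))| ≤ 24 / (((P.L ^ k : ℕ) : ℝ)) ^ 2 * (((P.L ^ k : ℕ) : ℝ)) ^ P.d := by
  have hnn : ∀ x : Site P 0, 0 ≤ ∏ ν ∈ Finset.univ.erase μ, (p ((x ν - h).val % P.L ^ k) * (if (iterBlockOf k (fun κ => x κ - h)) ν = y ν then (1 : ℝ) else 0) + (1 - p ((x ν - h).val % P.L ^ k)) * (if (iterBlockOf k (fun κ => x κ - h)) ν + 1 = y ν then (1 : ℝ) else 0)) :=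
    fun x => Finset.prod_nonneg fun ν _ => weightE_nonneg h p hp01 ν (y ν) x
  have hpt : ∀ x : Site P 0, |(∏ ν : Fin P.d, (p (((x.shift μ) ν - h).val % P.L ^ k) * (if (iterBlockOf k (fun κ => (x.shift μ) κ - h)) ν = y ν then (1 : ℝ) else 0) + (1 - p (((x.shift μ) ν - h).val % P.L ^ k)) * (if (iterBlockOf k (fun κ => (x.shift μ) κ - h)) ν + 1 = y ν then (1 : ℝ) else 0))) - 2 * (∏ ν : Fin P.d, (p ((x ν - h).val % P.L ^ k) * (if (iterBlockOf k (fun κ => x κ - h)) ν = y ν then (1 : ℝ) else 0) + (1 - p ((x ν - h).val % P.L ^ k)) * (if (iterBlockOf k (fun κ => x κ - h)) ν + 1 = y ν then (1 : ℝ) else 0))) + (∏ ν : Fin P.d, (p (((x.unshift μ) ν - h).val % P.L ^ k) * (if (iterBlockOf k (fun κ => (x.unshift μ) κ - h)) ν = y ν then (1 : ℝ) else 0) + (1 - p (((x.unshift μ) ν - h).val % P.L ^ k)) * (if (iterBlockOf k (fun κ => (x.unshift μ) κ - h)) ν + 1 = y ν then (1 : ℝ) else 0)))| ≤ 6 / (((P.L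 ^ k : ℕ) : ℝ)) ^ 2 * ((fun t : ZMod (P.sitesPerDir k) => (if t + 1 = y μ then (1 : ℝ) else 0) + 2 * (if t = y μ then (1 : ℝ) else 0) + (if t - 1 = y μ then (1 : ℝ) else 0)) ((iterBlockOf k (fun κ => x κ - h)) μ) * ∏ ν ∈ Finset.univ.erase μ, (p ((x ν - h).val % P.L ^ k) * (if (iterBlockOf k (fun κ => x κ - h)) ν = y ν then (1 : ℝ) else 0) + (1 - p ((x ν - h).val % P.L ^ k)) * (if (iterBlockOf k (fun κ => x κ - h)) ν + 1 = y ν then (1 : ℝ) else 0))) := by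
    intro x
    rw [secondDiff_weight_eq hk h p y μ x, abs_mul, abs_of_nonneg (hnn x), ← mul_assoc]
    exact mul_le_mul_of_nonneg_right (abs_secondDiff_weightE_le_ind hk h p hp0 hpℓ hpD hpc hpk0 hpk μ (y μ) x) (hnn x)
  refine (Finset.sum_le_sum fun x _ => hpt x).trans ?_
  rw [← Finset.mul_sum, sum_F_mul_prod_erase hk h p y μ (fun t : ZMod (P.sitesPerDir k) => (if t + 1 = y μ then (1 : ℝ) else 0) + 2 * (if t = y μ then (1 : ℝ) else 0) + (if t - 1 = y μ then (1 : ℝ) else 0))]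
  have h4 : ∑ t : ZMod (P.sitesPerDir k), (fun t : ZMod (P.sitesPerDir k) => (if t + 1 = y μ then (1 : ℝ) else 0) + 2 * (if t = y μ then (1 : ℝ) else 0) + (if t - 1 = y μ then (1 : ℝ) else 0)) t = 4 := by
    simp only []
    rw [Finset.sum_add_distrib, Finset.sum_add_distrib, ← Finset.mul_sum, sum_ind_add_one_eq, sum_ind_eq', sum_ind_sub_one_eq]; norm_num
  rw [h4]
  exact le_of_eq (by ring)

end Weight

end Summit.QuantumFields.YangMills.Theorems.Prop7HermiteCardinalWeightsColumns

end
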